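import Summits.AtomisticToContinuum.FouriersLaw.Theorems.PhononMeanFreePathDefs
import Summits.AtomisticToContinuum.FouriersLaw.Theorems.OddSectorIrreversibilityOddCorrectorDecayOneSite

/-!
# Light-cone stub, helper 5: `N`-uniform position moments of ALL orders at ALL sites under the Gibbs state

Helper for the registered stub `stub_lightCone` of line `two-horizons-forecast-loss`
(crux `PhononMeanFreePath.IncoherentChannel`, stmt-AtomisticToContinuum-11811), registered sub-goal
`lightCone_gibbs_position_moments`.

The Gibbs control needed by the light cone is on `sup_i |q_i|` along the stationary dynamics,
hence on the moments `E_{μ₀}[q_i^{2k}]` for EVERY site `i` of the `(N+1)`-chain, uniformly in `N`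
and `i`, for arbitrarily large `k`. We extend the transfer-operator argument of
`…GibbsPositionEighthMomentMarginal` (sites `0, 1`, power `8`) to all sites and all even powers:
integrating out the sites to the LEFT of `i` one at a time turns the problem at site `i` of an
`(n+1)`-chain with a radially non-increasing left weight `L(q₀)` into the same problem at site `i-1`
of an `n`-chain with the left weight `L'(b) = ∫ L(a) e^{-U(a)/T} e^{-V(b-a)/T} da` (again radially
non-increasing, Wintner's lemma); at site `0` the marginal is `e^{-U/T} · L · G` with the right factor
`G` of `exists_marginal_factor`, and Chebyshev's covariance inequality gives
`E_N[h(q_i)] ≤ ∫ h e^{-U/T} / ∫ e^{-U/T}` for every radially non-decreasing `h`.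
With `h(a) = a^{2k}`: `∫ q_i^{2k} dμ₀ ≤ C_k(ω₂, lam, T)`
for all `N`, all `i` (`lightCone_gibbs_position_moments`).
-/

noncomputable section

namespace Summit.AtomisticToContinuum.FouriersLaw.Theorems.PhononMeanFreePath

open MeasureTheory Set Filter Topology
open scoped NNReal ENNReal
open Literature.MathematicalPhysics.KineticTheory.HeatConduction
open Summit.AtomisticToContinuum.FouriersLaw.Theorems.SubdiffusiveBondHeat

/-! ### Even powers: one-site finiteness and the Gibbs moment bound -/

section Pinned

variable {ω₂ lam β : ℝ}

/-- `a ↦ a^{2k}` (in `ℝ≥0∞`) is radially non-decreasing. -/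
theorem lightCone_radMono_ofReal_pow_even (k : ℕ) :
    ∀ ⦃a b : ℝ⦄, |a| ≤ |b| → ENNReal.ofReal (a ^ (2 * k)) ≤ ENNReal.ofReal (b ^ (2 * k)) := by
  intro a b h
  refine ENNReal.ofReal_le_ofReal ?_
  have := pow_le_pow_left₀ (abs_nonneg a) h (2 * k)
  rwa [Even.pow_abs ⟨k, by ring⟩, Even.pow_abs ⟨k, by ring⟩] at this

/-- The even moments of the one-site weight are finite: `∫ a^{2k} e^{-U(a)/T} da < ∞`
(`ω₂, T > 0`, `lam ≥ 0`). -/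
theorem lightCone_lintegral_pow_exp_neg_U_ne_top (hω : 0 < ω₂) (hl : 0 ≤ lam) (γ : ℝ) {T : ℝ} (hT : 0 < T) (k : ℕ) :
    ∫⁻ a, ENNReal.ofReal (a ^ (2 * k)) * ENNReal.ofReal (Real.exp (-(pinnedChain ω₂ lam β γ).U a / T)) ≠ ⊤ := by
  have hUc : Continuous (pinnedChain ω₂ lam β γ).U := (pinnedChain_contDiff_U ω₂ lam β γ (n := 0)).continuous
  have hc : Continuous fun a : ℝ => a ^ (2 * k) * Real.exp (-(pinnedChain ω₂ lam β γ).U a / T) := by fun_prop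
  have h0 : ∀ a : ℝ, 0 ≤ a ^ (2 * k) := fun a => Even.pow_nonneg ⟨k, by ring⟩ a
  have e : (fun a : ℝ => ENNReal.ofReal (a ^ (2 * k)) * ENNReal.ofReal (Real.exp (-(pinnedChain ω₂ lam β γ).U a / T))) =
      fun a : ℝ => ENNReal.ofReal (a ^ (2 * k) * Real.exp (-(pinnedChain ω₂ lam β γ).U a / T)) := by
    funext a
    rw [ENNReal.ofReal_mul (h0 a)]
  rw [e]
  refine (lintegral_ofReal_ne_top_iff_integrable hc.aestronglyMeasurable
    (ae_of_all _ fun a => mul_nonneg (h0 a) (Real.exp_pos _).le)).mpr ?_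
  have hg : Integrable fun a : ℝ => a ^ (2 * k) * Real.exp (-(ω₂ / (2 * T)) * a ^ 2) := by
    have := integrable_rpow_mul_exp_neg_mul_sq (b := ω₂ / (2 * T)) (by positivity) (s := (2 * k : ℕ))
      (by have : (0 : ℝ) ≤ ((2 * k : ℕ) : ℝ) := Nat.cast_nonneg _; linarith)
    refine this.congr (ae_of_all _ fun a => ?_)
    simp only
    rw [Real.rpow_natCast]
  refine hg.mono' hc.aestronglyMeasurable (ae_of_all _ fun a => ?_)
  rw [Real.norm_eq_abs, abs_of_nonneg (mul_nonneg (h0 a) (Real.exp_pos _).le)]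
  exact mul_le_mul_of_nonneg_left (pinnedChain_exp_neg_U_div_le hl γ hT a) (h0 a)

/-- **Transfer to phase space** (even power `2k`): the configurational Chebyshev inequality
`(∫ q_i^{2k} e^{-Φ_N/T} dq) B ≤ A ∫ e^{-Φ_N/T} dq` with `A < ∞`, `0 < B < ∞` gives integrability of
`q_i^{2k}` under the Gibbs state and `∫ q_i^{2k} dμ₀ ≤ A/B` (the momenta factor off). -/
theorem lightCone_integrable_and_moment_le (hω : 0 < ω₂) (hl : 0 ≤ lam) (hβ : 0 ≤ β) (γ : ℝ) {T : ℝ}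
    (hT : 0 < T) {N : ℕ} (i : Fin N) (k : ℕ) {A B : ℝ≥0∞} (hA : A ≠ ⊤) (hB0 : B ≠ 0) (hB : B ≠ ⊤)
    (hq : (∫⁻ q : Fin N → ℝ, ENNReal.ofReal ((q i) ^ (2 * k)) *
        ENNReal.ofReal (Real.exp (-(pinnedChain ω₂ lam β γ).potential N q / T))) * B ≤
      A * ∫⁻ q : Fin N → ℝ, ENNReal.ofReal (Real.exp (-(pinnedChain ω₂ lam β γ).potential N q / T))) :
    Integrable (fun z : PhaseSpace N => (z.1 i) ^ (2 * k)) ((pinnedChain ω₂ lam β γ).gibbsMeasure N T) ∧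
      ∫ z, (z.1 i) ^ (2 * k) ∂((pinnedChain ω₂ lam β γ).gibbsMeasure N T) ≤ A.toReal / B.toReal := by
  set P := pinnedChain ω₂ lam β γ with hP
  have hev : ∀ a : ℝ, 0 ≤ a ^ (2 * k) := fun a => Even.pow_nonneg ⟨k, by ring⟩ a
  have hUc : Continuous P.U := (pinnedChain_contDiff_U ω₂ lam β γ (n := 0)).continuous
  have hVc : Continuous P.V := (pinnedChain_contDiff_V ω₂ lam β γ (n := 0)).continuous
  have hΦ : Measurable (P.potential N) := (continuous_potential P hUc hVc N).measurable
  have hρc : Continuous (P.gibbsDensity N T) := pinnedChain_continuous_gibbsDensity ω₂ lam β γ N T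
  have hKc : Continuous fun p : Fin N → ℝ => Real.exp (-(∑ j, p j ^ 2 / 2) / T) := by fun_prop
  set K : ℝ≥0∞ := ∫⁻ p : Fin N → ℝ, ENNReal.ofReal (Real.exp (-(∑ j, p j ^ 2 / 2) / T)) with hK
  have hρ : ∀ z : PhaseSpace N, P.gibbsDensity N T z =
      Real.exp (-P.potential N z.1 / T) * Real.exp (-(∑ j, z.2 j ^ 2 / 2) / T) := by
    intro z
    rw [OscillatorChain.gibbsDensity, P.hamiltonian_eq_kinetic_add_potential, ← Real.exp_add]
    congr 1
    ring
  have hI : ∫⁻ z : PhaseSpace N, ENNReal.ofReal ((z.1 i) ^ (2 * k) * P.gibbsDensity N T z) =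
      (∫⁻ q : Fin N → ℝ, ENNReal.ofReal ((q i) ^ (2 * k)) *
        ENNReal.ofReal (Real.exp (-P.potential N q / T))) * K := by
    rw [hK, ← lintegral_prod_mul (by fun_prop) hKc.measurable.ennreal_ofReal.aemeasurable]
    refine lintegral_congr fun z => ?_
    rw [hρ, ← mul_assoc, ENNReal.ofReal_mul (mul_nonneg (hev _) (Real.exp_pos _).le), ENNReal.ofReal_mul (hev _)]
  have hZ : ∫⁻ z : PhaseSpace N, ENNReal.ofReal (P.gibbsDensity N T z) =
      (∫⁻ q : Fin N → ℝ, ENNReal.ofReal (Real.exp (-P.potential N q / T))) * K := by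
    rw [hK, ← lintegral_prod_mul (by fun_prop) hKc.measurable.ennreal_ofReal.aemeasurable]
    refine lintegral_congr fun z => ?_
    rw [hρ, ENNReal.ofReal_mul (by positivity)]
  have key : (∫⁻ z : PhaseSpace N, ENNReal.ofReal ((z.1 i) ^ (2 * k) * P.gibbsDensity N T z)) * B ≤
      A * ∫⁻ z : PhaseSpace N, ENNReal.ofReal (P.gibbsDensity N T z) := by
    rw [hI, hZ, mul_right_comm, ← mul_assoc]
    exact mul_le_mul_left hq K
  have hρi : Integrable (P.gibbsDensity N T) := pinnedChain_integrable_gibbsDensity hω hl hβ γ N hT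
  have hZfin : ∫⁻ z : PhaseSpace N, ENNReal.ofReal (P.gibbsDensity N T z) ≠ ⊤ :=
    (lintegral_ofReal_ne_top_iff_integrable hρi.aestronglyMeasurable
      (ae_of_all _ fun z => (P.gibbsDensity_pos N T z).le)).mpr hρi
  have hIfin : ∫⁻ z : PhaseSpace N, ENNReal.ofReal ((z.1 i) ^ (2 * k) * P.gibbsDensity N T z) ≠ ⊤ := by
    intro h
    rw [h, ENNReal.top_mul hB0] at key
    exact absurd key (not_le.mpr (ENNReal.mul_lt_top hA.lt_top hZfin.lt_top))
  have hc : Continuous fun z : PhaseSpace N => (z.1 i) ^ (2 * k) * P.gibbsDensity N T z :=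
    (((continuous_apply i).comp continuous_fst).pow (2 * k)).mul hρc
  have hnn : ∀ z : PhaseSpace N, 0 ≤ (z.1 i) ^ (2 * k) * P.gibbsDensity N T z := fun z =>
    mul_nonneg (hev _) (P.gibbsDensity_pos N T z).le
  have hInt : Integrable (fun z : PhaseSpace N => (z.1 i) ^ (2 * k) * P.gibbsDensity N T z) :=
    (lintegral_ofReal_ne_top_iff_integrable hc.aestronglyMeasurable (ae_of_all _ hnn)).mp hIfin
  refine ⟨P.integrable_gibbsMeasure hInt, ?_⟩
  rw [P.integral_gibbsMeasure]
  have hZpos : 0 < ∫ z, P.gibbsDensity N T z := integral_exp_pos hρi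
  have e1 : ENNReal.ofReal (∫ z : PhaseSpace N, (z.1 i) ^ (2 * k) * P.gibbsDensity N T z) =
      ∫⁻ z : PhaseSpace N, ENNReal.ofReal ((z.1 i) ^ (2 * k) * P.gibbsDensity N T z) :=
    ofReal_integral_eq_lintegral_ofReal hInt (ae_of_all _ hnn)
  have e2 : ENNReal.ofReal (∫ z, P.gibbsDensity N T z) =
      ∫⁻ z : PhaseSpace N, ENNReal.ofReal (P.gibbsDensity N T z) :=
    ofReal_integral_eq_lintegral_ofReal hρi (ae_of_all _ fun z => (P.gibbsDensity_pos N T z).le)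
  have hreal : (∫ z : PhaseSpace N, (z.1 i) ^ (2 * k) * P.gibbsDensity N T z) * B.toReal ≤
      A.toReal * ∫ z, P.gibbsDensity N T z := by
    have := ENNReal.toReal_mono (ENNReal.mul_ne_top hA hZfin) key
    rwa [ENNReal.toReal_mul, ENNReal.toReal_mul, ← e1, ← e2,
      ENNReal.toReal_ofReal (integral_nonneg hnn), ENNReal.toReal_ofReal hZpos.le] at this
  have hBpos : 0 < B.toReal := ENNReal.toReal_pos hB0 hB
  rw [inv_mul_le_iff₀ hZpos, mul_div_assoc', le_div_iff₀ hBpos]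
  linarith [mul_comm A.toReal (∫ z, P.gibbsDensity N T z)]

end Pinned

/-- **Registered helper `lightCone_gibbs_position_moments` — `N`-uniform position moments of
all even orders at all sites.** For the pinned chain (`ω₂ > 0`, `lam, β ≥ 0`), `T > 0` and every
`k` there is `C = C_k(ω₂, lam, T)` (the `2k`-th moment of the one-site Gibbs state
`e^{-U/T}/∫e^{-U/T}`) such that for EVERY `N` and EVERY site `i` of the `(N+1)`-chain, `q_i^{2k}`
is `μ₀`-integrable and `∫ q_i^{2k} dμ₀ ≤ C` (`μ₀ = gibbsMeasure (N+1) T`). -/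
theorem lightCone_gibbs_position_moments : ∀ ω₂ lam β γ : ℝ, 0 < ω₂ → 0 ≤ lam → 0 ≤ β → ∀ T : ℝ, 0 < T →
    ∀ k : ℕ, ∃ C : ℝ, ∀ (N : ℕ) (i : Fin (N + 1)),
      Integrable (fun z : PhaseSpace (N + 1) => (z.1 i) ^ (2 * k)) ((pinnedChain ω₂ lam β γ).gibbsMeasure (N + 1) T) ∧
        ∫ z, (z.1 i) ^ (2 * k) ∂((pinnedChain ω₂ lam β γ).gibbsMeasure (N + 1) T) ≤ C := by
  intro ω₂ lam β γ hω hl hβ T hT k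
  have hA := lightCone_lintegral_pow_exp_neg_U_ne_top (β := β) hω hl γ hT k
  have hB := pinnedChain_lintegral_exp_neg_U_ne_top (β := β) hω hl γ hT
  have hB0 := pinnedChain_lintegral_exp_neg_U_ne_zero ω₂ lam β γ T
  refine ⟨(∫⁻ a, ENNReal.ofReal (a ^ (2 * k)) *
      ENNReal.ofReal (Real.exp (-(pinnedChain ω₂ lam β γ).U a / T))).toReal /
    (∫⁻ a, ENNReal.ofReal (Real.exp (-(pinnedChain ω₂ lam β γ).U a / T))).toReal, fun N i => ?_⟩
  have hUc : Continuous (pinnedChain ω₂ lam β γ).U := (pinnedChain_contDiff_U ω₂ lam β γ (n := 0)).continuous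
  have hVc : Continuous (pinnedChain ω₂ lam β γ).V := (pinnedChain_contDiff_V ω₂ lam β γ (n := 0)).continuous
  have hU := pinnedChain_U_radMono (β := β) hω.le hl γ
  have hV := pinnedChain_V_radMono hβ ω₂ lam γ
  have hkm : Measurable fun a : ℝ => ENNReal.ofReal (a ^ (2 * k)) := by fun_prop
  exact lightCone_integrable_and_moment_le hω hl hβ γ hT i k hA hB0 hB
    (Summit.AtomisticToContinuum.FouriersLaw.Theorems.ChainVariation.lintegral_coord_potential_le hUc hVc hU hV
      hT.le N i hkm (lightCone_radMono_ofReal_pow_even k))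

end Summit.AtomisticToContinuum.FouriersLaw.Theorems.PhononMeanFreePath

end
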